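import Summits.CriticalPhenomena.PercolationContinuityZ3.Theorems.PercNearOneGluingNoHeavyQuantBinomialExtremal
import Summits.CriticalPhenomena.PercolationContinuityZ3.Theorems.PercNearOneGluingNoHeavyQuantFarthestNearRoute
import Mathlib.Data.List.Sort
import HarnessLib

/-!
# QUANT lane R8, T-DEC: THE SUB-FLOOR HUB OF A LONG-TAIL SHAPE `(lo, K)`, `3lo ≤ 2K`, IS SDEC AT EVERY WIDTH `j ≥ 2K/lo`
# in the near-one regime `γᵢ ≥ 2/3` (census-1 gen 31)

builds on p205010 (kernel theorem, internal audit signed; external expert review pending)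

Support file (`--supports stmt-CriticalPhenomena-4575`), QUANT lane seat prim-quant-census-1 (gen 31); memo
`run/shared/lean/prim/quant/prim-quant-census-1/g31/HUB-GENERAL-G31.md` §0 (7).  Theorems only, standard axioms, no sorries.

THE RESULT (`sdec_sHub_long`).  `lo < K`, `3lo ≤ 2K` (long tail — the complementary regime `2K ≤ 3lo` is `…QuantShapeHubGeneral.sdec_sHub`,
every width `≥ 2`), gates `γᵢ ∈ [2/3, 1)` with `x(lo+K) ≤ lo + Kγᵢ`, `0 < x`, and width `2K ≤ lo·j`:
**`SDEC x ((lo+K)j) (sHub lo K P)`** — the sub-floor hub `δ_{lo·j} ∗ Π blob_K(γᵢ)` of every such list of far-giant pieces is SDEC at the floor.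
PROOF = the three tools of this seat: the farthest-near injective routes (`sdec_farthestNear`: at gate `T` with `lo j + K t* < T ≤ lo j + K(t*+1)`
the charged low `s` ships to atom `t* − s`, `r = t* − 2s`), the elementary-symmetric mass bound (`sHub_routeBoundES`) and binomial extremality
(`esL_odds_ge_binomial`), here in the variant `sHub_routeBound_nearOne'` with `c ≤ every γᵢ`, `c = max(2/3, (x(lo+K) − lo)/K)`, giving
`u_{t*−s} ≥ ω^r·u_s`, `ω = c/(1−c) ≥ 2`.  The width condition gives `r ≥ 2` and `ρ ≤ (r−1)/r` (`D ≤ K(r+1) − lo j ≤ K(r−1)`), so the credit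
part needs only `ω^r ≥ r − 1`; the floor part `x(1+ω^r) ≤ ω^r` follows from `x(1+ω²) ≤ ω²`, i.e. `x((1−c)²+c²) ≤ c²`, which is
`(lo + Kc)((1−c)² + c²) ≤ (lo+K)c² ⟸ Kc(2c−1) ≥ lo(1−c) ⟸ c ≥ 2/3, 3lo ≤ 2K`.  Numerically (memo §0 (7), code/exp17c) the same chain certifies
gates down to `1/2`; `[1/2, 2/3)` and the widths `K < lo·j < 2K` are left open here.

HONEST STATUS.  Hub-level result; the forest expansion for long tails also needs the piece-beside-a-blob base case beyond `K ≤ 2lo`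
(`sdec_pieceBlob`), which is open (memo §0 (5)).  `SiblingStep`, `GluedDominated'`, `SDECConvClosed`, `FarTreeRow` OPEN; RATE class (log\*) / honest
sentence of `run/shared/lean/prim/quant/README.md` unchanged.  [this work].  Nothing here is cited as a published result.  The gluing rows served
[cite: KozmaNitzan2024, Conjecture 3 (p. 15)]; product measure [cite: Grimmett1999, §1.3 p. 10].
-/

noncomputable section

open scoped BigOperators

namespace Summit.CriticalPhenomena.PercolationContinuityZ3.Theorems
namespace Quant
namespace LawDec

open Finset

/-- capacity from a ratio bound: `M(1+B) ≤ B`, `B·A ≤ C` (with `A, B ≥ 0`) ⟹ `M(A + C) ≤ C`. [this work] -/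
theorem cap_of_ratio {M B A C : ℝ} (hB : 0 ≤ B) (hMB : M * (1 + B) ≤ B) (hA : 0 ≤ A) (hb : B * A ≤ C) :
    M * (A + C) ≤ C := by
  have hM1 : M ≤ 1 := by nlinarith
  have h1 : M * A * (1 + B) ≤ B * A := by nlinarith [mul_le_mul_of_nonneg_right hMB hA]
  nlinarith [mul_nonneg (sub_nonneg.2 hM1) (sub_nonneg.2 hb), mul_nonneg hB hA]

/-- entries `≥ c` ⟹ `c·length ≤ sum`. [this work] -/
theorem le_sum_of_forall_le (c : ℝ) : ∀ L : List ℝ, (∀ x ∈ L, c ≤ x) → c * L.length ≤ L.sum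
  | [], _ => by simp
  | y :: L, h => by
    rw [List.sum_cons, List.length_cons]; push_cast
    have := le_sum_of_forall_le c L (fun x hx => h x (List.mem_cons_of_mem y hx))
    linarith [h y (by simp)]

/-- `Σ (lo + Kγᵢ) = lo·|P| + K·Σγᵢ`. [this work] -/
theorem sum_map_affine (lo K : ℝ) : ∀ P : List ℝ, (P.map (fun γ => lo + K * γ)).sum = lo * P.length + K * P.sum
  | [] => by simp
  | γ :: P => by rw [List.map_cons, List.sum_cons, List.sum_cons, List.length_cons, sum_map_affine lo K P]; push_cast; ring

/-- floor part of the long-tail capacity: `3lo ≤ 2K`, `c ≥ 2/3`, `x(lo+K) ≤ lo + Kc` ⟹ `x(1 + ω²) ≤ ω²`, `ω = c/(1−c)`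
(i.e. `x((1−c)² + c²) ≤ c²`, from `(lo+Kc)((1−c)²+c²) ≤ (lo+K)c² ⟸ Kc(2c−1) ≥ lo(1−c)`). [this work] -/
theorem longTail_floor_part (lo K x c : ℝ) (hlo : 0 ≤ lo) (hK : 0 < K) (h32 : 3 * lo ≤ 2 * K) (hc : 2 / 3 ≤ c) (hc1 : c < 1)
    (hx : x * (lo + K) ≤ lo + K * c) : x * (1 + (c / (1 - c)) ^ 2) ≤ (c / (1 - c)) ^ 2 := by
  have h1c : 0 < 1 - c := by linarith
  have hkey : lo * (1 - c) ≤ K * c * (2 * c - 1) := by nlinarith [mul_nonneg hK.le (sub_nonneg.2 hc)]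
  have hpoly : (lo + K * c) * ((1 - c) ^ 2 + c ^ 2) ≤ (lo + K) * c ^ 2 := by
    nlinarith [mul_nonneg h1c.le (sub_nonneg.2 hkey)]
  have hq : 0 < (1 - c) ^ 2 + c ^ 2 := by positivity
  have key : x * ((1 - c) ^ 2 + c ^ 2) ≤ c ^ 2 := by
    have : x * ((1 - c) ^ 2 + c ^ 2) * (lo + K) ≤ c ^ 2 * (lo + K) := by
      nlinarith [mul_le_mul_of_nonneg_right hx hq.le]
    exact le_of_mul_le_mul_right this (by linarith)
  have h1c2 : 0 < (1 - c) ^ 2 := by positivity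
  rw [div_pow, ← sub_nonneg]
  have e2 : c ^ 2 / (1 - c) ^ 2 - x * (1 + c ^ 2 / (1 - c) ^ 2) = (c ^ 2 - x * ((1 - c) ^ 2 + c ^ 2)) / (1 - c) ^ 2 := by
    field_simp
  rw [e2]; exact div_nonneg (by linarith) h1c2.le

/-- lifting the floor part along `ω² ≤ ω^r`: `x(1+B₂) ≤ B₂`, `B₂ ≤ B`, `x ≤ 1` ⟹ `x(1+B) ≤ B`. [this work] -/
theorem cap_ratio_mono {x B₂ B : ℝ} (h : x * (1 + B₂) ≤ B₂) (h2 : B₂ ≤ B) (hx1 : x ≤ 1) : x * (1 + B) ≤ B := by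
  nlinarith [mul_nonneg (sub_nonneg.2 hx1) (sub_nonneg.2 h2)]

/-- credit part of the long-tail capacity: `D ≤ K(r−1)`, `r ≤ B` ⟹ `(D/(Kr))(1 + B) ≤ B`. [this work] -/
theorem longTail_credit_part {D K r B : ℝ} (hK : 0 < K) (hr : 0 < r) (hD : D ≤ K * (r - 1)) (hB : r ≤ B) :
    D / (K * r) * (1 + B) ≤ B := by
  have hKr : 0 < K * r := mul_pos hK hr
  rw [div_mul_eq_mul_div, div_le_iff₀ hKr]
  have hB0 : 0 ≤ B := by linarith
  have h1 : D * (1 + B) ≤ K * (r - 1) * (1 + B) := mul_le_mul_of_nonneg_right hD (by linarith)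
  nlinarith [mul_le_mul_of_nonneg_left hB hK.le, mul_nonneg hK.le hB0]

/-- **near-one route bound, variant with `c` below every gate**: `lo < K`, gates in `[1/2,1)`, `s < j`, `c ∈ [1/2,1)`, `c ≤ γᵢ` for all `i` ⟹
`u(lo·j + K·s)·C(j−s, r)(c/(1−c))^r ≤ C(s+r, s)·u(lo·j + K·(s+r))`. [this work] -/
theorem sHub_routeBound_nearOne' (lo K : ℕ) (hloK : lo < K) (P : List ℝ) (hP : ∀ γ ∈ P, 1 / 2 ≤ γ ∧ γ < 1)
    (s r : ℕ) (hs : s < P.length) (c : ℝ) (hc : 1 / 2 ≤ c) (hc1 : c < 1) (hcP : ∀ γ ∈ P, c ≤ γ) :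
    sHub lo K P (lo * P.length + K * s) * ((((P.length - s).choose r : ℕ) : ℝ) * (c / (1 - c)) ^ r)
      ≤ ((s + r).choose s : ℝ) * sHub lo K P (lo * P.length + K * (s + r)) := by
  set P' : List ℝ := P.insertionSort (· ≤ ·) with hP'
  have hperm : P'.Perm P := List.perm_insertionSort _ P
  have hsort : P'.Pairwise (· ≤ ·) := List.pairwise_insertionSort _ P
  have hP'b : ∀ γ ∈ P', 1 / 2 ≤ γ ∧ γ < 1 := fun γ hγ => hP γ (hperm.mem_iff.mp hγ)
  set od : ℝ → ℝ := fun γ => γ / (1 - γ) with hod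
  have hOperm : (P'.map od).Perm (P.map od) := hperm.map od
  have hOsort : (P'.map od).Pairwise (· ≤ ·) := by
    rw [List.pairwise_map]
    refine hsort.imp_of_mem ?_
    intro a b ha hb hab
    have ha' := hP'b a ha; have hb' := hP'b b hb
    show a / (1 - a) ≤ b / (1 - b)
    rw [div_le_div_iff₀ (by linarith) (by linarith)]; nlinarith
  have hP01 : ∀ γ ∈ P, 0 ≤ γ ∧ γ < 1 := fun γ hγ => ⟨by linarith [(hP γ hγ).1], (hP γ hγ).2⟩
  have hES := sHub_routeBoundES lo K hloK P hP01 (P'.map od) hOperm hOsort s r hs.le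
  set n : ℕ := P.length - s with hn
  set L : List ℝ := P'.take n with hL
  have hlenP' : P'.length = P.length := hperm.length_eq
  have hLlen : L.length = n := by rw [hL, List.length_take]; omega
  have hLne : L ≠ [] := by
    intro h; have := congrArg List.length h; rw [hLlen] at this; simp at this; omega
  have hLb : ∀ γ ∈ L, 1 / 2 ≤ γ ∧ γ < 1 := fun γ hγ => hP'b γ (List.mem_of_mem_take hγ)
  have htake : (P'.map od).take n = L.map od := by rw [hL, List.map_take]
  have hLsum : c * L.length ≤ L.sum :=
    le_sum_of_forall_le c L (fun γ hγ => hcP γ (hperm.mem_iff.mp (List.mem_of_mem_take hγ)))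
  have hbin := esL_odds_ge_binomial L hLb hLne c (by linarith) hc1 hLsum r
  rw [hLlen] at hbin
  rw [htake] at hES
  have hu0 : 0 ≤ sHub lo K P (lo * P.length + K * s) :=
    (sHub_laws lo K P (fun γ hγ => ⟨(hP01 γ hγ).1, (hP01 γ hγ).2.le⟩)).1 _
  exact le_trans (mul_le_mul_of_nonneg_left hbin hu0) hES

/-- **the long-tail sub-floor hub is SDEC** (`lo < K`, `3lo ≤ 2K`, width `2K ≤ lo·j`, gates `γᵢ ∈ [2/3,1)` with `x(lo+K) ≤ lo + Kγᵢ`, `0 < x`):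
`SDEC x ((lo+K)j) (sHub lo K P)`. [this work] -/
theorem sdec_sHub_long (lo K : ℕ) (hloK : lo < K) (h32 : 3 * lo ≤ 2 * K) (x : ℝ) (hx0 : 0 < x) (P : List ℝ)
    (hj : 2 * K ≤ lo * P.length) (hP : ∀ γ ∈ P, 2 / 3 ≤ γ ∧ γ < 1 ∧ x * ((lo : ℝ) + K) ≤ lo + K * γ) :
    SDEC x ((lo + K) * P.length) (sHub lo K P) := by
  have hK : 0 < K := lt_of_le_of_lt (Nat.zero_le lo) hloK
  have hjK : K < lo * P.length := by omega
  have hK0 : (0 : ℝ) < K := by exact_mod_cast hK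
  have hlo0 : (0 : ℝ) ≤ lo := Nat.cast_nonneg lo
  have h32R : 3 * (lo : ℝ) ≤ 2 * K := by exact_mod_cast h32
  have hjKR : 2 * (K : ℝ) ≤ (lo : ℝ) * P.length := by exact_mod_cast hj
  have hPne : P ≠ [] := by
    intro h; rw [h] at hjK; simp at hjK
  have hPh : ∀ γ ∈ P, 1 / 2 ≤ γ ∧ γ < 1 := fun γ hγ => ⟨by linarith [(hP γ hγ).1], (hP γ hγ).2.1⟩
  have hP01 : ∀ γ ∈ P, 0 ≤ γ ∧ γ ≤ 1 := fun γ hγ => ⟨by linarith [(hP γ hγ).1], (hP γ hγ).2.1.le⟩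
  obtain ⟨h0, hM, h1, hmean⟩ := sHub_laws lo K P hP01
  rw [sum_map_affine] at hmean
  -- `x < 1`, the floor bound `x·top ≤ T₀`, `Λ < j`, `0 < T₀`
  obtain ⟨γ₁, hγ₁⟩ := List.exists_mem_of_ne_nil P hPne
  have hx1 : x < 1 := by
    have h := (hP γ₁ hγ₁).2.2
    have hγ1 : (lo : ℝ) + K * γ₁ < lo + K := by nlinarith [(hP γ₁ hγ₁).2.1]
    have hloK0 : (0 : ℝ) < lo + K := by linarith
    by_contra hx
    push Not at hx
    have : (lo : ℝ) + K ≤ x * (lo + K) := by nlinarith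
    linarith
  have hta : x * (((lo + K) * P.length : ℕ) : ℝ) ≤ (lo : ℝ) * P.length + K * P.sum := by
    have hs := le_sum_of_forall_le ((x * ((lo : ℝ) + K) - lo) / K) P (fun γ hγ => by
      rw [div_le_iff₀ hK0]; linarith [(hP γ hγ).2.2])
    have e : (x * ((lo : ℝ) + K) - lo) / K * (P.length : ℝ) * K = (x * ((lo : ℝ) + K) - lo) * P.length := by
      field_simp
    have hs' : (x * ((lo : ℝ) + K) - lo) * (P.length : ℝ) ≤ K * P.sum := by
      have := mul_le_mul_of_nonneg_right hs hK0.le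
      rw [e] at this; linarith
    push_cast
    have e2 : x * (((lo : ℝ) + K) * P.length) = (x * ((lo : ℝ) + K) - lo) * P.length + lo * P.length := by ring
    rw [e2]; linarith
  have hΛj : P.sum < P.length := (sum_bounds_nearOne P hPh).2 hPne
  have hΛ0 : (P.length : ℝ) / 2 ≤ P.sum := (sum_bounds_nearOne P hPh).1
  have hT0pos : 0 < (lo : ℝ) * P.length + K * P.sum := by
    have hj0 : (0 : ℝ) < P.length := by
      have : 0 < P.length := List.length_pos_iff.mpr hPne
      exact_mod_cast this
    have : (0 : ℝ) < K * P.sum := mul_pos hK0 (by linarith)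
    have : (0 : ℝ) ≤ (lo : ℝ) * P.length := mul_nonneg hlo0 hj0.le
    linarith
  have hsupp : ∀ h, sHub lo K P h ≠ 0 → ∃ s, h = lo * P.length + K * s := by
    intro h hh
    obtain ⟨s, hs, _⟩ := (sHub_struct lo K hloK 0 le_rfl P (fun γ hγ => ⟨(hP01 γ hγ).1, (hP01 γ hγ).2, by
      rw [zero_mul]; exact (hP01 γ hγ).1⟩)).1 h hh
    exact ⟨s, hs⟩
  refine sdec_farthestNear lo K P.length x ((lo : ℝ) * P.length + K * P.sum) (sHub lo K P) hK hjK hx0 hx1 h0 hM h1 hmean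
    hT0pos hta hsupp ?_
  intro T hTpos hTle t s hKt hTc h2s hlT _hμl
  set r : ℕ := t - 2 * s with hr
  have hts : t - s = s + r := by omega
  have hrR : ((r : ℕ) : ℝ) = (t : ℝ) - 2 * s := by
    rw [hr, Nat.cast_sub h2s.le]; push_cast; ring
  -- Step 1: `r ≥ 2`
  have hr2 : 2 ≤ r := by
    have h : (lo : ℝ) * P.length < K * ((r : ℝ) + 1) := by rw [hrR]; linarith
    have h' : (K : ℝ) * 2 < K * ((r : ℝ) + 1) := by linarith [lt_of_le_of_lt hjKR h]
    have h'' : (2 : ℝ) < (r : ℝ) + 1 := lt_of_mul_lt_mul_left h' hK0.le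
    have : (1 : ℝ) < r := by linarith
    exact_mod_cast this
  have hr2R : (2 : ℝ) ≤ r := by exact_mod_cast hr2
  have hr0 : (0 : ℝ) < r := by linarith
  -- Step 2: the deficit `D ≤ K(r−1)`
  have hD : T - 2 * ((lo : ℝ) * P.length + K * s) ≤ K * ((r : ℝ) - 1) := by
    have : T - 2 * ((lo : ℝ) * P.length + K * s) ≤ K * ((r : ℝ) + 1) - lo * P.length := by rw [hrR]; linarith
    linarith
  have hDpos : 0 < T - 2 * ((lo : ℝ) * P.length + K * s) := by linarith
  -- Step 3: `s < j`
  have htj : t < P.length := by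
    have hKΛ : (K : ℝ) * P.sum ≤ K * P.length := mul_le_mul_of_nonneg_left hΛj.le hK0.le
    have h1' : (K : ℝ) * t < K * P.length := by linarith
    have : (t : ℝ) < P.length := lt_of_mul_lt_mul_left h1' hK0.le
    exact_mod_cast this
  have hsj : s < P.length := by omega
  -- Step 4: the route bound with `c = max(2/3, (x(lo+K) − lo)/K)`
  set c : ℝ := max (2 / 3) ((x * ((lo : ℝ) + K) - lo) / K) with hc
  have hc23 : 2 / 3 ≤ c := le_max_left _ _
  have hcx : (x * ((lo : ℝ) + K) - lo) / K ≤ c := le_max_right _ _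
  have hc1 : c < 1 := by
    rw [hc, max_lt_iff]; refine ⟨by norm_num, ?_⟩
    rw [div_lt_iff₀ hK0]; nlinarith
  have hcP : ∀ γ ∈ P, c ≤ γ := fun γ hγ => by
    rw [hc, max_le_iff]; refine ⟨(hP γ hγ).1, ?_⟩
    rw [div_le_iff₀ hK0]; linarith [(hP γ hγ).2.2]
  have hRB := sHub_routeBound_nearOne' lo K hloK P hPh s r hsj c (by linarith) hc1 hcP
  set ω : ℝ := c / (1 - c) with hω
  have h1c : 0 < 1 - c := by linarith
  have hω2 : 2 ≤ ω := by rw [hω, le_div_iff₀ h1c]; linarith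
  have hω0 : 0 ≤ ω := by linarith
  -- Step 5: `u_{s+r} ≥ ω^r · u_s`
  have hu0 : 0 ≤ sHub lo K P (lo * P.length + K * s) := h0 _
  have huh0 : 0 ≤ sHub lo K P (lo * P.length + K * (s + r)) := h0 _
  have hchoose : (((s + r).choose s : ℕ) : ℝ) ≤ (((P.length - s).choose r : ℕ) : ℝ) := by
    have e : (s + r).choose s = (s + r).choose r := Nat.choose_symm_add
    rw [e]; exact_mod_cast Nat.choose_le_choose r (by omega : s + r ≤ P.length - s)
  have hCpos : (0 : ℝ) < (((s + r).choose s : ℕ) : ℝ) := by exact_mod_cast Nat.choose_pos (by omega)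
  have hωr : 0 ≤ ω ^ r := pow_nonneg hω0 r
  have hb : ω ^ r * sHub lo K P (lo * P.length + K * s) ≤ sHub lo K P (lo * P.length + K * (s + r)) := by
    have h1 : sHub lo K P (lo * P.length + K * s) * ((((s + r).choose s : ℕ) : ℝ) * ω ^ r)
        ≤ sHub lo K P (lo * P.length + K * s) * ((((P.length - s).choose r : ℕ) : ℝ) * ω ^ r) :=
      mul_le_mul_of_nonneg_left (mul_le_mul_of_nonneg_right hchoose hωr) hu0
    have h2 := le_trans h1 hRB
    have h3 : (((s + r).choose s : ℕ) : ℝ) * (ω ^ r * sHub lo K P (lo * P.length + K * s))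
        ≤ (((s + r).choose s : ℕ) : ℝ) * sHub lo K P (lo * P.length + K * (s + r)) := by
      have e : sHub lo K P (lo * P.length + K * s) * ((((s + r).choose s : ℕ) : ℝ) * ω ^ r)
          = (((s + r).choose s : ℕ) : ℝ) * (ω ^ r * sHub lo K P (lo * P.length + K * s)) := by ring
      rw [← e]; exact h2
    exact le_of_mul_le_mul_left h3 hCpos
  -- Step 6: `ω^r ≥ ω²` and `ω^r ≥ r`
  have hωr2 : ω ^ 2 ≤ ω ^ r := pow_le_pow_right₀ (by linarith) hr2
  have hωr_r : (r : ℝ) ≤ ω ^ r := by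
    have h2r : (r : ℝ) < (2 : ℝ) ^ r := by exact_mod_cast Nat.lt_two_pow_self
    have : (2 : ℝ) ^ r ≤ ω ^ r := pow_le_pow_left₀ (by norm_num) hω2 r
    linarith
  -- floor part and credit part
  have hKc : x * ((lo : ℝ) + K) ≤ lo + K * c := by
    have := hcx; rw [div_le_iff₀ hK0] at this; linarith
  have hxω2 : x * (1 + ω ^ 2) ≤ ω ^ 2 := longTail_floor_part lo K x c hlo0 hK0 h32R hc23 hc1 hKc
  have hxωr : x * (1 + ω ^ r) ≤ ω ^ r := cap_ratio_mono hxω2 hωr2 hx1.le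
  have hρ : (T - 2 * ((lo : ℝ) * P.length + K * s)) / ((K : ℝ) * (r : ℝ)) * (1 + ω ^ r) ≤ ω ^ r :=
    longTail_credit_part hK0 hr0 hD hωr_r
  -- assemble
  rw [hts, max_mul_of_nonneg _ _ (add_nonneg hu0 huh0)]
  exact max_le (cap_of_ratio hωr hxωr hu0 hb) (cap_of_ratio hωr hρ hu0 hb)

end LawDec
end Quant
end Summit.CriticalPhenomena.PercolationContinuityZ3.Theorems
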